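import Summits.BirchSwinnertonDyer.BirchSwinnertonDyer.Theorems.GenusKolyvaginAtTwoGenusPrimitiveSupplyAtTwoTwistingPrimeDepthClass
import HarnessLib

/-!
# Route `GenusKolyvaginAtTwo`, crux #2 `GenusPrimitiveSupplyAtTwo` (stmt-BirchSwinnertonDyer-22136):
# Mazur–Rubin 2010 Lemma 3.6 at `p = 2` and the SPLIT twisting primes of Prop. 5.2 (`Frob_p = 1` on `E[2]`,
# `p ≡ 1 (mod m)`, two independent Selmer classes both alive at `p`) — unconditionally (Čebotarev is proved)

Lead seat `bsd-line-gk2-p1` g8 (cell `bsd-f1-sign2`). THEOREMS ONLY (no definition, no named fact, no `sorry`);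
helper `--supports stmt-BirchSwinnertonDyer-22136`; no item is closed; BSD is not proved by any of this.

WHY. The crux's TWIN SUPPLY (registered stub A `stub_minimalTwinSupplyAtTwo`: a Kolyvagin-admissible Heegner field
`K` whose twin `E^{(d_K)}` is `2`-Selmer-minimal) is proved in the tree (gk2-p5 g0,
`GenusKolyTwin.minimalSelmerTwinSupply_of_lowering`, p591445) from Modularity, the `2`-parity theorem, Cassels–Tate and
ONE further named print input `hMR` = Mazur–Rubin 2010 **Prop. 5.2** over `ℚ` in the form its proof gives
(`MazurRubin2010.prop52_rat`): «`E(ℚ)[2] = 0`, `d₂(E) > 1` ⟹ for every modulus `m` a prime `p ≡ 1 (mod m)` with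
`d₂(E^{(p)}) = d₂(E) − 2`». This file proves the GALOIS half of Prop. 5.2 for `ρ̄_{E,2}` onto (the crux's habitat):

* §1 `not_mem_torsionLocalKer_of_h1Eval_frob_ne_zero` — the easy half of the local criterion (Gross 1991 Prop. 9.6 /
  McCallum §3 (3)) at a Frobenius `γ` acting TRIVIALLY on `E[n]`: `[x, γ] ≠ 0 ⟹ x_v ≠ 0` (any number field; the
  companion of gk2-p4's `not_mem_torsionLocalKer_of_h1Eval_sq_ne_zero`, which is the case `γ²`).
* §2 **`exists_mem_h1Eval_ne_pair`** = Mazur–Rubin **Lemma 3.6** at `p = 2` in the tree's `h1Eval` currency: for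
  `ρ̄_{E,2}` onto, a conjugation-stable `B ≤ Γ_{ℚ(E[2])}` and classes `x, y` with `[x,·]`, `[y,·]`, `[x,·] − [y,·]` not
  identically zero on `B`, ONE `t ∈ B` has `([x,t], [y,t])` an `𝔽₂`-BASIS of `E[2]` (both evaluation maps are onto
  `E[2]` by gk2-p4's dichotomy; a three-case walk in the group `E[2]` of order `4`).
* §3 **`exists_splitTwistingPrime_pair`** — Čebotarev (tree theorem `frobenius_dense` ∘ `chebotarev_artinRep_holds`):
  for `ρ̄_{E,2}` onto, `x ≠ y` non-zero in `H¹(ℚ, E[2])`, `m ≥ 1`, an open commutator-closed `A ≤ Γ_ℚ`, a finite set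
  of primes `B₀` and of places `S'` to avoid, there is a prime `ℓ ∉ B₀`, **`ℓ ≡ 1 (mod m)`**, a place `v ∋ ℓ` off `S'`
  whose arithmetic Frobenius `t` lies in `Γ_{ℚ(E[2])} ∩ A` (so `E[2] ⊂ E(ℚ_ℓ)`), and `x`, `y`, `x + y`, `x − y` are
  ALL non-zero in `H¹(ℚ_ℓ, E[2])` — i.e. `loc_ℓ` maps `⟨x, y⟩` ONTO the `2`-dimensional `H¹_f(ℚ_ℓ, E[2]) = E[2]`,
  the hypothesis `dim V_T = 2` of Cor. 3.4 (i) in the proof of Prop. 5.2. No sign condition on `Δ`, no complex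
  conjugation: these primes SPLIT `E[2]` completely (contrast gk2-p4's `c₀·t`-primes, which are Kolyvagin primes).

The Selmer half of Prop. 5.2 (`#Sel₂(E^{(ℓ)})·4 = #Sel₂(E)` at such a prime, from the X11b sandwich, the Poitou–Tate
count and the lead's Lemma 2.11 of p622198) is the companion file `…TwistSelmerTransferDownTwo`.

References: [MazurRubin2010] B. Mazur, K. Rubin, *Ranks of twists of elliptic curves and Hilbert's tenth problem*, Invent.
Math. 181 (2010) = arXiv:0904.3709: Lemma 3.5–3.6 (p. 9), Prop. 5.2 and its proof (p. 12); [GrossLMS1991] §9 Prop. 9.1,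
9.6; [McCallumLMS1991] §3 (2)–(3); [LawsonWuthrich2016] Lemma 6; [SerreAbelianLadic1968] I §2.2 (Čebotarev).
-/

set_option linter.dupNamespace false -- tree convention: `Summit.BirchSwinnertonDyer.BirchSwinnertonDyer.Theorems` (summit = sub-problem)
set_option autoImplicit false

noncomputable section

open scoped Classical Pointwise

namespace Summit.BirchSwinnertonDyer.BirchSwinnertonDyer.Theorems.GenusKolyLowering

open WeierstrassCurve NumberField IsDedekindDomain Field
open Literature.NumberTheory.GaloisRepresentations Literature.NumberTheory.EllipticCurves
open Literature.NumberTheory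
open Summit.BirchSwinnertonDyer.BirchSwinnertonDyer.Theorems.GenusKolyTwistingPrime

/-! ## §1 The easy half of the local criterion at a Frobenius acting trivially on `E[n]` -/

section Local

universe u

variable {K : Type u} [Field K] [NumberField K] (W : WeierstrassCurve K) {v : HeightOneSpectrum (𝓞 K)}

/-- **`x_v ≠ 0` from a Frobenius acting trivially on `E[n]` with `[x, Frob] ≠ 0`.** For a finite place `v` of
`K`, an arithmetic Frobenius `γ` at some prime of `\bar ℤ_K` above `v` with `γ ∈ Γ_{K(E[n])}` and `[x, γ] ≠ 0`, the
class `x ∈ H¹(K, E[n])` does not die in `H¹(K_v, E[n])`: conjugate `γ` to a Frobenius `F` at the prime cut out by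
the chosen embedding `K̄ → K̄_v` (`exists_isArithFrobAt_conj_of_mem_primesAbove_holds`); `F ∈ G_𝔓 ∩ Γ_{K(E[n])}` and
`[x, F]` is a `Γ_K`-translate of `[x, γ] ≠ 0`, contradicting `h1Eval_eq_zero_of_mem_torsionLocalKer`. (Mazur–Rubin:
«the localization map `Sel₂(E/K) → H¹_f(K_𝔭, E[2])` is given by evaluation of cocycles at `Frob_𝔭 = γ`».)
[cite: MazurRubin2010, proof of Prop. 5.2 (arXiv:0904.3709 p. 12)] [cite: GrossLMS1991, Prop. 9.6]
[cite: McCallumLMS1991, §3 (3)] -/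
theorem not_mem_torsionLocalKer_of_h1Eval_frob_ne_zero [W.IsElliptic] {n : ℕ} (hn : n ≠ 0)
    {𝔓₀ : Ideal (absIntegers (𝓞 K) K)} (h𝔓₀ : 𝔓₀ ∈ v.primesAbove) {γ : absoluteGaloisGroup K}
    (hγ : IsArithFrobAt (𝓞 K) γ 𝔓₀) (hγT : γ ∈ torsionFixing W (n : ℤ))
    {x : galH1Torsion W (n : ℤ)} (hval : h1Eval W (n : ℤ) x γ ≠ 0) :
    x ∉ W.torsionLocalKer (v.adicCompletion K) (n : ℤ) := by
  intro hxloc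
  haveI : CharZero (v.adicCompletion K) :=
    charZero_of_injective_algebraMap (algebraMap K (v.adicCompletion K)).injective
  obtain ⟨𝔐, h𝔐⟩ := v.localPrimesAbove_nonempty
  set 𝔓w := v.primeBelow (closureEmb (K := K) (v.adicCompletion K)) 𝔐 with h𝔓w_def
  have h𝔓w : 𝔓w ∈ v.primesAbove := v.primeBelow_mem_primesAbove h𝔐
  obtain ⟨δ, -, hF⟩ :=
    HeightOneSpectrum.exists_isArithFrobAt_conj_of_mem_primesAbove_holds h𝔓₀ h𝔓w hγ
  haveI : 𝔓w.IsPrime := h𝔓w.1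
  have hFst : δ * γ * δ⁻¹ ∈ 𝔓w.decompositionSubgroup (absoluteGaloisGroup K) := hF.mem_stabilizer
  have hFT : δ * γ * δ⁻¹ ∈ torsionFixing W (n : ℤ) := (torsionFixing_normal W _).conj_mem _ hγT δ
  have hsurjv : Function.Surjective (torsionPointsMap W (v.adicCompletion K) (n : ℤ)) :=
    (torsionPointsMap_bijective W (v.adicCompletion K) hn).2
  have h0 := h1Eval_eq_zero_of_mem_torsionLocalKer W (n : ℤ) h𝔐 hFst hFT hsurjv hxloc
  rw [h1Eval_conj W _ x δ hγT] at h0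
  exact hval ((smul_eq_zero_iff_eq δ).mp h0)

end Local

/-! ## §2 Mazur–Rubin Lemma 3.6 at `p = 2`: one `t ∈ B` with `([x,t], [y,t])` a basis of `E[2]` -/

section Lemma36

variable (W : WeierstrassCurve ℚ) [W.IsElliptic]

omit [W.IsElliptic] in
/-- In `E[2]`: `a + b = 0 ↔ a = b` (`2b = 0`). [folklore] -/
theorem geomTorsion_two_add_eq_zero_iff (a b : geomTorsion W (2 : ℤ)) : a + b = 0 ↔ a = b := by
  have h2 : b + b = 0 := by rw [← two_nsmul]; exact AddSubgroup.torsionBy.nsmul b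
  constructor
  · intro h
    rw [eq_neg_of_add_eq_zero_left h, neg_eq_of_add_eq_zero_left h2]
  · rintro rfl; exact h2

/-- `E[2]` has an element different from any two given ones (`#E[2] = 4 > 2`). [cite: SilvermanAEC2009, Cor. III.6.4(b)] -/
theorem exists_geomTorsion_two_ne_ne (a b : geomTorsion W (2 : ℤ)) :
    ∃ P : geomTorsion W (2 : ℤ), P ≠ a ∧ P ≠ b := by
  by_contra hcon
  push Not at hcon
  have hcard : Nat.card (geomTorsion W (2 : ℤ)) = 4 := natCard_geomTorsion_two_rat W
  haveI : Finite (geomTorsion W (2 : ℤ)) := Nat.finite_of_card_ne_zero (by rw [hcard]; norm_num)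
  let f : Bool → geomTorsion W (2 : ℤ) := fun i ↦ if i then a else b
  have hf : Function.Surjective f := fun P ↦ by
    by_cases hPa : P = a
    · exact ⟨true, by simp [f, hPa]⟩
    · exact ⟨false, by simp [f, (hcon P hPa).symm]⟩
  have hle := Nat.card_le_card_of_surjective f hf
  rw [hcard, Nat.card_eq_fintype_card, Fintype.card_bool] at hle
  omega

/-- **Mazur–Rubin 2010, Lemma 3.6 at `p = 2` (kernel form).** Let `ρ̄_{W,2}` be onto, `B ≤ Γ_{ℚ(E[2])}` a subgroup
stable under conjugation by `Γ_ℚ`, and `x, y ∈ H¹(ℚ, E[2])` such that none of `[x,·]`, `[y,·]`, `[x,·] − [y,·]` vanishes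
identically on `B` (for `B = Γ_{ℚ(E[2]) F}` with `F/ℚ` abelian this is `x ≠ 0`, `y ≠ 0`, `x ≠ y`: §3). Then some `t ∈ B`
has `[x,t] ≠ 0`, `[y,t] ≠ 0`, `[x,t] ≠ [y,t]` — i.e. `([x,t], [y,t])` is an `𝔽₂`-basis of `E[2]`. Proof: both `[x,·]`
and `[y,·]` map `B` ONTO `E[2]` (gk2-p4's dichotomy `forall_h1Eval_eq_zero_or_forall_exists_h1Eval_eq`: the image is a
non-zero `Γ_ℚ`-stable subgroup and `Γ_ℚ` is transitive on `E[2] ∖ 0`); starting from `ρ₀` with `[x,ρ₀] ≠ [y,ρ₀]`, if one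
of the two values vanishes, multiply by a `ρ₁ ∈ B` with the vanishing class taking a third value `P₁ ∉ {0, [·,ρ₀]}` and
sort the three possibilities for the other class (`[·, ρ₀ρ₁] = [·,ρ₀] + [·,ρ₁]` on `Γ_{ℚ(E[2])}`). Printed statement:
«Suppose `E(K)[2] = 0`, and `c₁, c₂` are cocycles representing distinct nonzero elements of `H¹(K,E[2])`. Then there is
a `γ ∈ G_K` such that `γ|_{MK^{ab}} = 1` and `c₁(γ), c₂(γ)` are an `𝔽₂`-basis of `E[2]`.»
[cite: MazurRubin2010, Lemma 3.6 (arXiv:0904.3709 p. 9, «Lemma (selind2)»)] [cite: GrossLMS1991, §9 Prop. 9.1] -/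
theorem exists_mem_h1Eval_ne_pair (hsurj : W.HasSurjectiveModNGaloisRep 2)
    (x y : galH1Torsion W (2 : ℤ)) (B : Subgroup (absoluteGaloisGroup ℚ))
    (hBT : B ≤ torsionFixing W (2 : ℤ))
    (hBconj : ∀ (σ : absoluteGaloisGroup ℚ) {h : absoluteGaloisGroup ℚ}, h ∈ B → σ * h * σ⁻¹ ∈ B)
    (hx : ∃ h ∈ B, h1Eval W (2 : ℤ) x h ≠ 0) (hy : ∃ h ∈ B, h1Eval W (2 : ℤ) y h ≠ 0)
    (hxy : ∃ h ∈ B, h1Eval W (2 : ℤ) x h ≠ h1Eval W (2 : ℤ) y h) :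
    ∃ t ∈ B, h1Eval W (2 : ℤ) x t ≠ 0 ∧ h1Eval W (2 : ℤ) y t ≠ 0 ∧
      h1Eval W (2 : ℤ) x t ≠ h1Eval W (2 : ℤ) y t := by
  -- both evaluation maps are onto `E[2]` on `B`
  have honto : ∀ z : galH1Torsion W (2 : ℤ), (∃ h ∈ B, h1Eval W (2 : ℤ) z h ≠ 0) →
      ∀ P : geomTorsion W (2 : ℤ), ∃ h ∈ B, h1Eval W (2 : ℤ) z h = P := fun z hz ↦ by
    rcases forall_h1Eval_eq_zero_or_forall_exists_h1Eval_eq W hsurj z B hBT hBconj with h0 | h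
    · obtain ⟨h, hhB, hh⟩ := hz
      exact absurd (h0 h hhB) hh
    · exact h
  obtain ⟨ρ₀, hρ₀B, hρ₀⟩ := hxy
  have hρ₀T : ρ₀ ∈ torsionFixing W (2 : ℤ) := hBT hρ₀B
  -- generic step: if `[z₁, ρ₀] = 0` (so `[z₂, ρ₀] ≠ 0`) we repair with a `ρ₁`
  have step : ∀ z₁ z₂ : galH1Torsion W (2 : ℤ), (∃ h ∈ B, h1Eval W (2 : ℤ) z₁ h ≠ 0) →
      h1Eval W (2 : ℤ) z₁ ρ₀ = 0 → h1Eval W (2 : ℤ) z₂ ρ₀ ≠ 0 →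
      ∃ t ∈ B, h1Eval W (2 : ℤ) z₁ t ≠ 0 ∧ h1Eval W (2 : ℤ) z₂ t ≠ 0 ∧
        h1Eval W (2 : ℤ) z₁ t ≠ h1Eval W (2 : ℤ) z₂ t := by
    intro z₁ z₂ hz₁ ha hb
    set b := h1Eval W (2 : ℤ) z₂ ρ₀ with hb_def
    obtain ⟨P₁, hP₁0, hP₁b⟩ := exists_geomTorsion_two_ne_ne W 0 b
    obtain ⟨ρ₁, hρ₁B, hρ₁⟩ := honto z₁ hz₁ P₁
    set d := h1Eval W (2 : ℤ) z₂ ρ₁ with hd_def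
    have hmul₁ : h1Eval W (2 : ℤ) z₁ (ρ₀ * ρ₁) = P₁ := by
      rw [h1Eval_mul W _ z₁ hρ₀T, ha, hρ₁, zero_add]
    have hmul₂ : h1Eval W (2 : ℤ) z₂ (ρ₀ * ρ₁) = b + d := by
      rw [h1Eval_mul W _ z₂ hρ₀T]
    by_cases hd0 : d = 0
    · refine ⟨ρ₀ * ρ₁, B.mul_mem hρ₀B hρ₁B, ?_, ?_, ?_⟩
      · rw [hmul₁]; exact hP₁0
      · rw [hmul₂, hd0, add_zero]; exact hb
      · rw [hmul₁, hmul₂, hd0, add_zero]; exact hP₁b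
    by_cases hdP : d = P₁
    · refine ⟨ρ₀ * ρ₁, B.mul_mem hρ₀B hρ₁B, ?_, ?_, ?_⟩
      · rw [hmul₁]; exact hP₁0
      · rw [hmul₂, hdP]
        intro h
        exact hP₁b ((geomTorsion_two_add_eq_zero_iff W b P₁).mp h).symm
      · rw [hmul₁, hmul₂, hdP]
        intro h
        exact hb (by simpa using h)
    · exact ⟨ρ₁, hρ₁B, by rw [hρ₁]; exact hP₁0, hd0, by rw [hρ₁]; exact Ne.symm hdP⟩
  by_cases ha : h1Eval W (2 : ℤ) x ρ₀ = 0
  · have hb : h1Eval W (2 : ℤ) y ρ₀ ≠ 0 := fun hb ↦ hρ₀ (by rw [ha, hb])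
    exact step x y hx ha hb
  by_cases hb : h1Eval W (2 : ℤ) y ρ₀ = 0
  · obtain ⟨t, htB, h1, h2, h3⟩ := step y x hy hb ha
    exact ⟨t, htB, h2, h1, Ne.symm h3⟩
  · exact ⟨ρ₀, hρ₀B, ha, hb, hρ₀⟩

end Lemma36

/-! ## §3 The split twisting primes of Prop. 5.2: `Frob_ℓ ∈ Γ_{ℚ(E[2])}`, `ℓ ≡ 1 (mod m)`, two classes alive at `ℓ` -/

section Split

variable (W : WeierstrassCurve ℚ) [W.IsElliptic]

/-- **THE TWISTING PRIMES OF MAZUR–RUBIN PROP. 5.2 AT `2` EXIST (unconditionally).** Let `W/ℚ` be elliptic with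
`ρ̄_{W,2}` onto, `x, y ∈ H¹(ℚ, E[2])` non-zero and distinct, `A ≤ Γ_ℚ` an OPEN subgroup containing all commutators (the
fixer of any finite abelian extension), `m ≥ 1`, `B₀` a finite set of primes and `S'` a finite set of places. Then there
is a prime `ℓ ∉ B₀` with `ℓ ∤ m`, **`ℓ ≡ 1 (mod m)`**, a place `v ∋ ℓ` off `S'` and an arithmetic Frobenius `t` at a prime
above `v` with `t ∈ Γ_{ℚ(E[2])} ∩ A` (so `t` fixes `E[2]` pointwise), `([x,t], [y,t])` an `𝔽₂`-basis of `E[2]`, and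
consequently `x`, `y`, `x + y`, `x − y` all OUTSIDE `ker (H¹(ℚ,E[2]) → H¹(ℚ_v,E[2]))`. This is the choice of `𝔭` in the
proof of Prop. 5.2: «By Lemma 3.6 we can find `γ ∈ G_K` such that `γ|_{MK(8Δ∞)} = 1`, `c₁(γ), c₂(γ)` are an
`𝔽₂`-basis of `E[2]` … Let `𝔭` be a prime … whose Frobenius in `Gal(N/K)` is the conjugacy class of `γ` … the classes
`loc_T(c₁)` and `loc_T(c₂)` generate `H¹_f(K_𝔭,E[2])`». Proof: §2 on `B = Γ_{ℚ(E[2], ζ_m)} ∩ A` (the three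
non-vanishings are free there by the commutator reduction `exists_torsionFixing_mem_h1Eval_ne_of_commutator_mem`
applied to `x`, `y`, `x − y`); Čebotarev (`frobenius_dense`, proved in the tree) in the open set `t₀·(𝒩_{x,y} ∩ Stab ζ_m ∩ A)`;
`ℓ ≡ 1 (mod m)` from `tζ = ζ = ζ^ℓ`; `[z, t] = [z, t₀]` for `z = x, y`; §1.
[cite: MazurRubin2010, Prop. 5.2 (proof, arXiv:0904.3709 p. 12) with Lemma 3.6 (p. 9)] [cite: GrossLMS1991, §9 Prop. 9.6]
[cite: SerreAbelianLadic1968, Ch. I §2.2 (Čebotarev)] -/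
theorem exists_splitTwistingPrime_pair (hsurj : W.HasSurjectiveModNGaloisRep 2)
    {x y : galH1Torsion W (2 : ℤ)} (hx : x ≠ 0) (hy : y ≠ 0) (hxy : x ≠ y)
    (A : Subgroup (absoluteGaloisGroup ℚ)) (hAopen : IsOpen (A : Set (absoluteGaloisGroup ℚ)))
    (hA : ∀ γ δ : absoluteGaloisGroup ℚ, γ * δ * γ⁻¹ * δ⁻¹ ∈ A)
    {m : ℕ} (hm : m ≠ 0) (B₀ : Finset ℕ) {S' : Set (HeightOneSpectrum (𝓞 ℚ))} (hS' : S'.Finite) :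
    ∃ ℓ : ℕ, ∃ _ : Fact ℓ.Prime, ℓ ∉ B₀ ∧ ¬ ℓ ∣ m ∧ (ℓ : ℤ) ≡ 1 [ZMOD (m : ℤ)] ∧
      ∃ (v : HeightOneSpectrum (𝓞 ℚ)) (𝔓 : Ideal (absIntegers (𝓞 ℚ) ℚ)) (t : absoluteGaloisGroup ℚ),
        v ∉ S' ∧ (ℓ : 𝓞 ℚ) ∈ v.asIdeal ∧ 𝔓 ∈ v.primesAbove ∧ IsArithFrobAt (𝓞 ℚ) t 𝔓 ∧
        t ∈ torsionFixing W (2 : ℤ) ∧ t ∈ A ∧ (∀ P : geomTorsion W (2 : ℤ), t • P = P) ∧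
        h1Eval W (2 : ℤ) x t ≠ 0 ∧ h1Eval W (2 : ℤ) y t ≠ 0 ∧ h1Eval W (2 : ℤ) x t ≠ h1Eval W (2 : ℤ) y t ∧
        x ∉ W.torsionLocalKer (v.adicCompletion ℚ) (2 : ℤ) ∧ y ∉ W.torsionLocalKer (v.adicCompletion ℚ) (2 : ℤ) ∧
        x + y ∉ W.torsionLocalKer (v.adicCompletion ℚ) (2 : ℤ) ∧
        x - y ∉ W.torsionLocalKer (v.adicCompletion ℚ) (2 : ℤ) := by
  classical
  haveI : NeZero m := ⟨hm⟩
  have hn0 : (2 : ℤ) ≠ 0 := two_ne_zero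
  set T := torsionFixing W (2 : ℤ) with hTdef
  have hTopen : IsOpen (T : Set (absoluteGaloisGroup ℚ)) := isOpen_torsionFixing W hn0
  -- a primitive `m`-th root of unity
  have hq0 : ((m : ℕ) : AlgebraicClosure ℚ) ≠ 0 := by exact_mod_cast hm
  haveI : NeZero ((m : ℕ) : AlgebraicClosure ℚ) := ⟨hq0⟩
  obtain ⟨ζ, hζ⟩ := IsAlgClosed.exists_root (Polynomial.cyclotomic m (AlgebraicClosure ℚ))
    (Polynomial.degree_cyclotomic_pos m _ (Nat.pos_of_ne_zero hm)).ne'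
  have hprim : IsPrimitiveRoot ζ m := Polynomial.isRoot_cyclotomic_iff.mp hζ
  have hpow : ∀ σ : absoluteGaloisGroup ℚ, ∃ i : ℕ, σ • ζ = ζ ^ i := fun σ ↦ by
    have h1 : (σ • ζ) ^ m = 1 := by rw [← smul_pow', hprim.pow_eq_one, smul_one]
    obtain ⟨i, -, hi⟩ := hprim.eq_pow_of_pow_eq_one h1
    exact ⟨i, hi.symm⟩
  set St : Subgroup (absoluteGaloisGroup ℚ) := MulAction.stabilizer (absoluteGaloisGroup ℚ) ζ with hSt
  have hStopen : IsOpen (St : Set (absoluteGaloisGroup ℚ)) := isOpen_stabilizer_absoluteGaloisGroup ζ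
  have hStconj : ∀ (σ : absoluteGaloisGroup ℚ) {h : absoluteGaloisGroup ℚ}, h ∈ St →
      σ * h * σ⁻¹ ∈ St := by
    intro σ h hh
    change (σ * h * σ⁻¹) • ζ = ζ
    have hh' : h • ζ = ζ := hh
    obtain ⟨i, hi⟩ := hpow σ⁻¹
    rw [mul_smul, mul_smul, hi, smul_pow', hh', ← hi, smul_inv_smul]
  -- ### abelian side conditions are free: `A' = Stab ζ ⊓ A` is commutator-closed
  set A' : Subgroup (absoluteGaloisGroup ℚ) := St ⊓ A with hA'
  have hA'comm : ∀ γ δ : absoluteGaloisGroup ℚ, γ * δ * γ⁻¹ * δ⁻¹ ∈ A' := fun γ δ ↦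
    ⟨commutator_smul_rootOfUnity hprim γ δ, hA γ δ⟩
  -- ### the conjugation-stable subgroup `B = Γ_{ℚ(E[2], ζ)} ∩ A` and Lemma 3.6 on it
  set B : Subgroup (absoluteGaloisGroup ℚ) := T ⊓ A' with hB
  have hBT : B ≤ torsionFixing W (2 : ℤ) := fun h hh ↦ hh.1
  have hBconj : ∀ (σ : absoluteGaloisGroup ℚ) {h : absoluteGaloisGroup ℚ}, h ∈ B → σ * h * σ⁻¹ ∈ B :=
    fun σ h hh ↦ ⟨(torsionFixing_normal W _).conj_mem h hh.1 σ,
      ⟨hStconj σ hh.2.1, conj_mem_of_commutator_mem hA σ hh.2.2⟩⟩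
  have hmove : ∀ z : galH1Torsion W (2 : ℤ), z ≠ 0 → ∃ h ∈ B, h1Eval W (2 : ℤ) z h ≠ 0 := fun z hz ↦ by
    obtain ⟨h, hT, hA'', hh⟩ := exists_torsionFixing_mem_h1Eval_ne_of_commutator_mem W hsurj
      (n := (2 : ℤ)) (dvd_refl _) (exists_torsionFixing_h1Eval_ne_of_ne_zero W hsurj hz) A' hA'comm
    exact ⟨h, ⟨hT, hA''⟩, hh⟩
  have hx' := hmove x hx
  have hy' := hmove y hy
  have hxy' : ∃ h ∈ B, h1Eval W (2 : ℤ) x h ≠ h1Eval W (2 : ℤ) y h := by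
    obtain ⟨h, hhB, hh⟩ := hmove (x - y) (sub_ne_zero.mpr hxy)
    refine ⟨h, hhB, fun heq ↦ hh ?_⟩
    rw [sub_eq_add_neg, h1Eval_add W _ x (-y) (hBT hhB), h1Eval_neg W _ y (hBT hhB), heq, add_neg_cancel]
  obtain ⟨t₀, ht₀B, ht₀x, ht₀y, ht₀xy⟩ := exists_mem_h1Eval_ne_pair W hsurj x y B hBT hBconj hx' hy' hxy'
  have ht₀T : t₀ ∈ torsionFixing W (2 : ℤ) := hBT ht₀B
  have ht₀ζ : t₀ • ζ = ζ := ht₀B.2.1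
  have ht₀A : t₀ ∈ A := ht₀B.2.2
  -- ### the finite exceptional set of places of `ℚ`
  set Bx : Finset ℕ := m.primeFactors ∪ B₀ with hBx
  set S : Set (HeightOneSpectrum (𝓞 ℚ)) :=
    {v | ∃ q ∈ Bx, q.Prime ∧ (q : 𝓞 ℚ) ∈ v.asIdeal} ∪ S' with hS
  have hSfin : S.Finite := by
    refine Set.Finite.union ?_ hS'
    have : {v : HeightOneSpectrum (𝓞 ℚ) | ∃ q ∈ Bx, q.Prime ∧ (q : 𝓞 ℚ) ∈ v.asIdeal} ⊆
        ⋃ q ∈ (Bx.filter Nat.Prime), {v | (q : 𝓞 ℚ) ∈ v.asIdeal} := by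
      intro v ⟨q, hqB, hq, hqv⟩
      simp only [Set.mem_iUnion, Finset.mem_filter]
      exact ⟨q, ⟨hqB, hq⟩, hqv⟩
    refine Set.Finite.subset (Set.Finite.biUnion (Finset.finite_toSet _) fun q hq ↦ ?_) this
    rw [Finset.coe_filter, Set.mem_setOf_eq] at hq
    have hsub : {v : HeightOneSpectrum (𝓞 ℚ) | (q : 𝓞 ℚ) ∈ v.asIdeal}.Subsingleton :=
      fun v hv v' hv' ↦ HeightOneSpectrum.eq_of_natCast_mem_rat hq.2 hv hv'
    exact hsub.finite
  -- ### Čebotarev: a Frobenius in the open set `t₀ · (𝒩 ∩ Stab ζ ∩ A)`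
  set xs : Bool → galH1Torsion W (2 : ℤ) := fun i ↦ if i then x else y with hxs
  set 𝒩 := evalKer W (2 : ℤ) xs with h𝒩
  have h𝒩open : IsOpen (𝒩 : Set (absoluteGaloisGroup ℚ)) :=
    isOpen_evalKer W _ _ (isOpen_torsionFixing W hn0)
  set U : Set (absoluteGaloisGroup ℚ) := ((𝒩 : Set _) ∩ (St : Set _)) ∩ (A : Set _) with hU
  have hUopen : IsOpen U := (h𝒩open.inter hStopen).inter hAopen
  set O : Set (absoluteGaloisGroup ℚ) := (fun γ ↦ t₀ * γ) '' U with hO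
  have hOopen : IsOpen O := (Homeomorph.mulLeft t₀).isOpenMap _ hUopen
  have hOne : O.Nonempty := ⟨t₀ * 1, 1, ⟨⟨𝒩.one_mem, St.one_mem⟩, A.one_mem⟩, rfl⟩
  obtain ⟨γ, hγO, v, hvS, 𝔓₀, h𝔓₀, hγ⟩ :=
    (absoluteGaloisGroup.frobenius_dense Automorphic.chebotarev_artinRep_holds ℚ S hSfin
      ).inter_open_nonempty O hOopen hOne
  obtain ⟨u, ⟨⟨hu𝒩, huSt⟩, huA⟩, rfl⟩ := hγO
  have huT : u ∈ torsionFixing W (2 : ℤ) := hu𝒩.1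
  have hux : h1Eval W (2 : ℤ) x u = 0 := by simpa [hxs] using hu𝒩.2 true
  have huy : h1Eval W (2 : ℤ) y u = 0 := by simpa [hxs] using hu𝒩.2 false
  have huζ : u • ζ = ζ := huSt
  set t := t₀ * u with ht
  have htT : t ∈ torsionFixing W (2 : ℤ) := mul_mem ht₀T huT
  have htA : t ∈ A := mul_mem ht₀A huA
  have hvS' : v ∉ S' := fun h ↦ hvS (Or.inr h)
  -- ### the rational prime `ℓ` under `v`
  set ℓ : ℕ := (Rat.HeightOneSpectrum.primesEquiv (R := 𝓞 ℚ) v : ℕ) with hℓdef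
  have hℓ : ℓ.Prime := (Rat.HeightOneSpectrum.primesEquiv (R := 𝓞 ℚ) v).2
  haveI hℓF : Fact ℓ.Prime := ⟨hℓ⟩
  have hℓv : (ℓ : 𝓞 ℚ) ∈ v.asIdeal := by
    have h := (Rat.HeightOneSpectrum.natGenerator_dvd_iff (R := 𝓞 ℚ) v (n := ℓ)).mp dvd_rfl
    rw [Ideal.mem_map_iff_of_surjective _ (Rat.IsIntegralClosure.intEquiv (𝓞 ℚ)).surjective] at h
    obtain ⟨z, hz, hzℓ⟩ := h
    have : z = (ℓ : 𝓞 ℚ) :=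
      (Rat.IsIntegralClosure.intEquiv (𝓞 ℚ)).injective (by rw [hzℓ, map_natCast])
    rwa [this] at hz
  have hℓB : ℓ ∉ Bx := fun h ↦ hvS (Or.inl ⟨ℓ, h, hℓ, hℓv⟩)
  simp only [hBx, Finset.mem_union, Nat.mem_primeFactors, not_or] at hℓB
  obtain ⟨hℓm', hℓB₀⟩ := hℓB
  have hℓm : ¬ ℓ ∣ m := fun h ↦ hℓm' ⟨hℓ, h, hm⟩
  -- ### `ℓ ≡ 1 (mod m)`: the Frobenius fixes `ζ` and raises it to the `ℓ`-th power
  have hmv : (m : 𝓞 ℚ) ∉ v.asIdeal := natCast_not_mem_of_not_dvd hℓ hℓv hℓm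
  have h1 : (t₀ * u) • ζ = ζ := by rw [mul_smul, huζ, ht₀ζ]
  have h2 : (t₀ * u) • ζ = ζ ^ v.residueCard :=
    smul_eq_pow_residueCard_of_isArithFrobAt_of_pow_eq_one hmv h𝔓₀ hγ hprim.pow_eq_one
  rw [residueCard_eq_of_natCast_mem_rat hℓ hℓv, h1] at h2
  have hζ0 : ζ ≠ 0 := hprim.ne_zero hm
  have hℓ1 : 1 ≤ ℓ := hℓ.one_lt.le
  have hζ1 : ζ ^ (ℓ - 1) = 1 := by
    have h3 : ζ ^ (ℓ - 1) * ζ = 1 * ζ := by rw [← pow_succ, Nat.sub_add_cancel hℓ1, ← h2, one_mul]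
    exact mul_right_cancel₀ hζ0 h3
  have hmdvd : m ∣ ℓ - 1 := (hprim.pow_eq_one_iff_dvd (ℓ - 1)).mp hζ1
  have hmod : (ℓ : ℤ) ≡ 1 [ZMOD (m : ℤ)] := by
    have h := Int.natCast_dvd_natCast.mpr hmdvd
    rw [Nat.cast_sub hℓ1, Nat.cast_one] at h
    exact (Int.modEq_iff_dvd.mpr h).symm
  -- ### values of the classes at `t`
  have hfix : ∀ P : geomTorsion W (2 : ℤ), t • P = P := fun P ↦ smul_eq_of_mem_torsionFixing W _ htT P
  have hxt : h1Eval W (2 : ℤ) x t = h1Eval W (2 : ℤ) x t₀ := by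
    rw [ht, h1Eval_mul W _ x ht₀T, hux, add_zero]
  have hyt : h1Eval W (2 : ℤ) y t = h1Eval W (2 : ℤ) y t₀ := by
    rw [ht, h1Eval_mul W _ y ht₀T, huy, add_zero]
  have hvx : h1Eval W (2 : ℤ) x t ≠ 0 := by rw [hxt]; exact ht₀x
  have hvy : h1Eval W (2 : ℤ) y t ≠ 0 := by rw [hyt]; exact ht₀y
  have hvxy : h1Eval W (2 : ℤ) x t ≠ h1Eval W (2 : ℤ) y t := by rw [hxt, hyt]; exact ht₀xy
  have hvadd : h1Eval W (2 : ℤ) (x + y) t ≠ 0 := by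
    rw [h1Eval_add W _ x y htT]
    exact fun h ↦ hvxy ((geomTorsion_two_add_eq_zero_iff W _ _).mp h)
  have hvsub : h1Eval W (2 : ℤ) (x - y) t ≠ 0 := by
    rw [sub_eq_add_neg, h1Eval_add W _ x (-y) htT, h1Eval_neg W _ y htT, ← sub_eq_add_neg]
    exact sub_ne_zero.mpr hvxy
  -- ### the local criterion at `v`
  have hloc : ∀ z : galH1Torsion W (2 : ℤ), h1Eval W (2 : ℤ) z t ≠ 0 →
      z ∉ W.torsionLocalKer (v.adicCompletion ℚ) (2 : ℤ) := fun z hz ↦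
    not_mem_torsionLocalKer_of_h1Eval_frob_ne_zero W (n := 2) two_ne_zero h𝔓₀ hγ htT hz
  exact ⟨ℓ, hℓF, hℓB₀, hℓm, hmod, v, 𝔓₀, t, hvS', hℓv, h𝔓₀, hγ, htT, htA, hfix, hvx, hvy, hvxy,
    hloc x hvx, hloc y hvy, hloc (x + y) hvadd, hloc (x - y) hvsub⟩

end Split

end Summit.BirchSwinnertonDyer.BirchSwinnertonDyer.Theorems.GenusKolyLowering

end
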